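import Mathlib.LinearAlgebra.Matrix.NonsingularInverse
import Mathlib.Data.Real.Basic
import Mathlib.Tactic.Linarith
import HarnessLib

/-!
# One cycle of the dual simplex method (Luenberger–Ye, §4.5)

[LY08] = D. G. Luenberger, Y. Ye, *Linear and Nonlinear Programming* [LuenbergerYe2008], chapter
"Duality" (Ch. 4 in the held copy `book:luenberger2008-linear-nonlinear-programming` and in the
Springer 2008 printing), §4.5 "The dual simplex method", displays (9)–(14) and Steps 1–2 with the
convergence observations (a)–(b).

Setting (9): `minimize cᵀx subject to Ax = b, x ≥ 0`, basis `B` (`m × m`, nonsingular) with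
nonbasic columns `D` (`m × k`), basic costs `c_B`, nonbasic costs `c_D`; a vector `λ` with
`λᵀB = c_Bᵀ` ((10a), e.g. the simplex multipliers `λᵀ = c_BᵀB⁻¹`) that is dual feasible,
`z_j = λᵀa_j ≤ c_j` on the nonbasic columns ((10b)); current tableau `Y = B⁻¹D` (`y_ij`) and basic
values `x_B = B⁻¹b`. With `uⁱ` the `i`th row of `B⁻¹` (`binvRow`), the dual simplex move is
(11) `λ̄ᵀ = λᵀ − εuⁱ` (`dualSimplexStep`).

Results recorded:
* `binvRow_vecMul_basis` — `uⁱB = e_iᵀ`; `transpose_mulVec_binvRow` — `uⁱa_j = y_ij`;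
* (12a)/(12b) `basis_transpose_mulVec_dualSimplexStep` — `λ̄ᵀa_j = c_j` for basic `j ≠ i` and
  `λ̄ᵀa_i = c_i − ε` (as the vector identity `Bᵀλ̄ = c_B − εe_i`), with the pointwise forms
  `dualSimplexStep_basic_ne` and `dualSimplexStep_basic_self`;
* (12c) `nonbasic_transpose_mulVec_dualSimplexStep` — `λ̄ᵀa_j = z_j − εy_ij` on the nonbasic columns;
* (13) `dualSimplexStep_dotProduct_rhs` — `λ̄ᵀb = λᵀb − εx_{Bi}`;
* Step 2, first case: `dualSimplexStep_feasible_of_row_nonneg` — if all `y_ij ≥ 0` then `λ̄` is dual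
  feasible for every `ε ≥ 0`, and `dual_unbounded_of_row_nonneg` — with `x_{Bi} < 0` the dual
  objective then exceeds every bound ("the dual has no maximum");
* Step 2, ratio (14): `dualRatio_nonneg` (`(z_j − c_j)/y_ij ≥ 0` for `y_ij < 0`),
  `dualSimplexStep_feasible_of_le_ratio` — for `0 ≤ ε ≤ min {(z_j − c_j)/y_ij : y_ij < 0}` the new `λ̄`
  is again dual feasible on the nonbasic columns (observation (a)), and `dualSimplexStep_tight_at_ratio` —
  at `ε₀ = (z_k − c_k)/y_ik` the `k`th inequality becomes an equality (`a_k` enters the basis);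
* observation (b): `dualSimplexStep_objective_gt` — with `x_{Bi} < 0` and `ε > 0` the dual objective
  strictly increases (`dualSimplexStep_objective_ge` for `ε ≥ 0`).

Published results only (Lean placement rule): every public declaration carries its
`[cite: LuenbergerYe2008, §4.5 …]` locator.
-/

namespace Literature.Analysis.Convex.DualSimplexMethod

open Matrix

variable {m k : Type*} [Fintype m] [DecidableEq m]

/-- `uⁱ`, the `i`th row of `B⁻¹`. [cite: LuenbergerYe2008, §4.5 (11) ("Denote the ith row of B⁻¹ by uⁱ")] -/
noncomputable def binvRow (B : Matrix m m ℝ) (i : m) : m → ℝ := fun l => B⁻¹ i l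

/-- The dual simplex move (11): `λ̄ᵀ = λᵀ − εuⁱ`. [cite: LuenbergerYe2008, §4.5 (11)] -/
noncomputable def dualSimplexStep (B : Matrix m m ℝ) (lam : m → ℝ) (i : m) (ε : ℝ) : m → ℝ :=
  lam - ε • binvRow B i

/-- `uⁱB = e_iᵀ`: the `i`th row of `B⁻¹B = I`. [cite: LuenbergerYe2008, §4.5 (12a)-(12b)
("noting that uⁱa_i = y_ii" with B⁻¹B = I)] -/
theorem binvRow_vecMul_basis {B : Matrix m m ℝ} (hB : IsUnit B.det) (i : m) :
    binvRow B i ᵥ* B = Pi.single i 1 := by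
  have h : binvRow B i ᵥ* B = fun j => (B⁻¹ * B) i j := by
    ext j
    rw [vecMul, dotProduct, Matrix.mul_apply]
    rfl
  rw [h, nonsing_inv_mul B hB]
  ext j
  by_cases hij : i = j
  · subst hij
    rw [Matrix.one_apply_eq, Pi.single_eq_same]
  · rw [Matrix.one_apply_ne hij, Pi.single_eq_of_ne (Ne.symm hij)]

/-- (12a)/(12b) as one vector identity: `Bᵀλ̄ = c_B − εe_i`, given (10a) `Bᵀλ = c_B`.
[cite: LuenbergerYe2008, §4.5 (12a), (12b)] -/
theorem basis_transpose_mulVec_dualSimplexStep {B : Matrix m m ℝ} (hB : IsUnit B.det) {lam cB : m → ℝ}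
    (hlam : Bᵀ *ᵥ lam = cB) (i : m) (ε : ℝ) :
    Bᵀ *ᵥ dualSimplexStep B lam i ε = cB - ε • Pi.single i 1 := by
  unfold dualSimplexStep
  rw [mulVec_sub, hlam, mulVec_smul, mulVec_transpose, binvRow_vecMul_basis hB]

/-- (12a): for a basic column `j ≠ i`, `λ̄ᵀa_j = c_j` stays an equality.
[cite: LuenbergerYe2008, §4.5 (12a)] -/
theorem dualSimplexStep_basic_ne {B : Matrix m m ℝ} (hB : IsUnit B.det) {lam cB : m → ℝ}
    (hlam : Bᵀ *ᵥ lam = cB) {i j : m} (hji : j ≠ i) (ε : ℝ) :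
    (Bᵀ *ᵥ dualSimplexStep B lam i ε) j = cB j := by
  rw [basis_transpose_mulVec_dualSimplexStep hB hlam, Pi.sub_apply, Pi.smul_apply,
    Pi.single_eq_of_ne hji, smul_zero, sub_zero]

/-- (12b): for the leaving column, `λ̄ᵀa_i = c_i − ε` (the equality becomes an inequality for
`ε > 0`). [cite: LuenbergerYe2008, §4.5 (12b)] -/
theorem dualSimplexStep_basic_self {B : Matrix m m ℝ} (hB : IsUnit B.det) {lam cB : m → ℝ}
    (hlam : Bᵀ *ᵥ lam = cB) (i : m) (ε : ℝ) :
    (Bᵀ *ᵥ dualSimplexStep B lam i ε) i = cB i - ε := by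
  rw [basis_transpose_mulVec_dualSimplexStep hB hlam, Pi.sub_apply, Pi.smul_apply, Pi.single_eq_same,
    smul_eq_mul, mul_one]

/-- `uⁱa_j = y_ij`: pricing the nonbasic columns with the `i`th row of `B⁻¹` gives row `i` of the
tableau `Y = B⁻¹D`. [cite: LuenbergerYe2008, §4.5 (12c) ("uⁱa_i = y_ii, the ijth element of the
tableau")] -/
theorem transpose_mulVec_binvRow (B : Matrix m m ℝ) (D : Matrix m k ℝ) (i : m) (j : k) :
    (Dᵀ *ᵥ binvRow B i) j = (B⁻¹ * D) i j := by
  simp only [mulVec, dotProduct, Matrix.mul_apply, transpose_apply, binvRow, mul_comm]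

/-- (12c): on the nonbasic columns `λ̄ᵀa_j = z_j − εy_ij` with `z_j = λᵀa_j` and `Y = B⁻¹D`.
[cite: LuenbergerYe2008, §4.5 (12c)] -/
theorem nonbasic_transpose_mulVec_dualSimplexStep (B : Matrix m m ℝ) (D : Matrix m k ℝ) (lam : m → ℝ)
    (i : m) (ε : ℝ) (j : k) :
    (Dᵀ *ᵥ dualSimplexStep B lam i ε) j = (Dᵀ *ᵥ lam) j - ε * (B⁻¹ * D) i j := by
  unfold dualSimplexStep
  rw [mulVec_sub, mulVec_smul, Pi.sub_apply, Pi.smul_apply, smul_eq_mul, transpose_mulVec_binvRow]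

/-- (13): `λ̄ᵀb = λᵀb − εx_{Bi}` with `x_B = B⁻¹b`. [cite: LuenbergerYe2008, §4.5 (13)] -/
theorem dualSimplexStep_dotProduct_rhs (B : Matrix m m ℝ) (lam b : m → ℝ) (i : m) (ε : ℝ) :
    dualSimplexStep B lam i ε ⬝ᵥ b = lam ⬝ᵥ b - ε * (B⁻¹ *ᵥ b) i := by
  unfold dualSimplexStep binvRow
  rw [sub_dotProduct, smul_dotProduct, smul_eq_mul]
  rfl

/-- Step 2, first case: if all `y_ij ≥ 0` in row `i`, then by (12) `λ̄` remains dual feasible for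
every `ε ≥ 0` (basic block: `Bᵀλ̄ = c_B − εe_i ≤ c_B`; nonbasic block: `z_j − εy_ij ≤ z_j ≤ c_j`).
[cite: LuenbergerYe2008, §4.5 Step 2 ("λ̄ is feasible for all ε > 0")] -/
theorem dualSimplexStep_feasible_of_row_nonneg {B : Matrix m m ℝ} (hB : IsUnit B.det) (D : Matrix m k ℝ)
    {lam cB : m → ℝ} {cD : k → ℝ} (hlam : Bᵀ *ᵥ lam = cB) (hz : ∀ j, (Dᵀ *ᵥ lam) j ≤ cD j)
    {i : m} (hy : ∀ j, 0 ≤ (B⁻¹ * D) i j) {ε : ℝ} (hε : 0 ≤ ε) :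
    (∀ l, (Bᵀ *ᵥ dualSimplexStep B lam i ε) l ≤ cB l) ∧ ∀ j, (Dᵀ *ᵥ dualSimplexStep B lam i ε) j ≤ cD j := by
  refine ⟨fun l => ?_, fun j => ?_⟩
  · rw [basis_transpose_mulVec_dualSimplexStep hB hlam, Pi.sub_apply, Pi.smul_apply, smul_eq_mul,
      Pi.single_apply]
    split_ifs <;> nlinarith
  · rw [nonbasic_transpose_mulVec_dualSimplexStep]
    nlinarith [hz j, hy j]

/-- Step 2, first case, conclusion: with `x_{Bi} < 0` and all `y_ij ≥ 0` the dual objective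
`λ̄ᵀb = λᵀb − εx_{Bi}` exceeds every bound along dual feasible points — "the dual has no maximum"
(and the primal (9) is infeasible). [cite: LuenbergerYe2008, §4.5 Step 2 (the dual has no maximum)] -/
theorem dual_unbounded_of_row_nonneg {B : Matrix m m ℝ} (hB : IsUnit B.det) (D : Matrix m k ℝ)
    {lam cB b : m → ℝ} {cD : k → ℝ} (hlam : Bᵀ *ᵥ lam = cB) (hz : ∀ j, (Dᵀ *ᵥ lam) j ≤ cD j)
    {i : m} (hy : ∀ j, 0 ≤ (B⁻¹ * D) i j) (hx : (B⁻¹ *ᵥ b) i < 0) (M : ℝ) :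
    ∃ ε : ℝ, 0 ≤ ε ∧ (∀ l, (Bᵀ *ᵥ dualSimplexStep B lam i ε) l ≤ cB l) ∧
      (∀ j, (Dᵀ *ᵥ dualSimplexStep B lam i ε) j ≤ cD j) ∧ M < dualSimplexStep B lam i ε ⬝ᵥ b := by
  set x := (B⁻¹ *ᵥ b) i with hxdef
  refine ⟨max 0 ((M - lam ⬝ᵥ b) / (-x) + 1), le_max_left _ _,
    (dualSimplexStep_feasible_of_row_nonneg hB D hlam hz hy (le_max_left _ _)).1,
    (dualSimplexStep_feasible_of_row_nonneg hB D hlam hz hy (le_max_left _ _)).2, ?_⟩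
  rw [dualSimplexStep_dotProduct_rhs, ← hxdef]
  have hx' : 0 < -x := by linarith
  have h1 : ((M - lam ⬝ᵥ b) / (-x) + 1) * (-x) = (M - lam ⬝ᵥ b) + (-x) := by
    rw [add_mul, one_mul, div_mul_cancel₀ _ hx'.ne']
  have h2 : ((M - lam ⬝ᵥ b) / (-x) + 1) * (-x) ≤ max 0 ((M - lam ⬝ᵥ b) / (-x) + 1) * (-x) :=
    mul_le_mul_of_nonneg_right (le_max_right _ _) hx'.le
  nlinarith

/-- The ratios in (14) are nonnegative: `z_j ≤ c_j` and `y_ij < 0` give `(z_j − c_j)/y_ij ≥ 0`.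
[cite: LuenbergerYe2008, §4.5 (14)] -/
theorem dualRatio_nonneg {z c y : ℝ} (hz : z ≤ c) (hy : y < 0) : 0 ≤ (z - c) / y :=
  div_nonneg_of_nonpos (by linarith) hy.le

/-- Step 2, ratio test (14) — observation (a): for `0 ≤ ε ≤ (z_j − c_j)/y_ij` whenever `y_ij < 0`
(in particular for `ε = ε₀`, the minimum ratio), the new vector is again dual feasible on the
nonbasic columns: `λ̄ᵀa_j = z_j − εy_ij ≤ c_j` for all `j`.
[cite: LuenbergerYe2008, §4.5 (14) and observation (a)] -/
theorem dualSimplexStep_feasible_of_le_ratio (B : Matrix m m ℝ) (D : Matrix m k ℝ) {lam : m → ℝ}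
    {cD : k → ℝ} (hz : ∀ j, (Dᵀ *ᵥ lam) j ≤ cD j) {i : m} {ε : ℝ} (hε : 0 ≤ ε)
    (hratio : ∀ j, (B⁻¹ * D) i j < 0 → ε ≤ ((Dᵀ *ᵥ lam) j - cD j) / (B⁻¹ * D) i j) (j : k) :
    (Dᵀ *ᵥ dualSimplexStep B lam i ε) j ≤ cD j := by
  rw [nonbasic_transpose_mulVec_dualSimplexStep]
  by_cases hy : (B⁻¹ * D) i j < 0
  · have h := hratio j hy
    rw [le_div_iff_of_neg hy] at h
    linarith
  · have hy' := not_lt.mp hy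
    nlinarith [hz j, hy']

/-- Step 2, ratio test (14): at `ε₀ = (z_k − c_k)/y_ik` (`y_ik < 0`) the `k`th dual inequality
becomes an equality, `λ̄ᵀa_k = c_k` — `a_k` replaces `a_i` in the basis.
[cite: LuenbergerYe2008, §4.5 (14) ("Form a new basis B by replacing a_i by a_k")] -/
theorem dualSimplexStep_tight_at_ratio (B : Matrix m m ℝ) (D : Matrix m k ℝ) (lam : m → ℝ) (cD : k → ℝ)
    {i : m} {kk : k} (hy : (B⁻¹ * D) i kk < 0) :
    (Dᵀ *ᵥ dualSimplexStep B lam i (((Dᵀ *ᵥ lam) kk - cD kk) / (B⁻¹ * D) i kk)) kk = cD kk := by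
  rw [nonbasic_transpose_mulVec_dualSimplexStep, div_mul_cancel₀ _ hy.ne]
  ring

/-- Observation (b): by (13) and the choice `x_{Bi} < 0`, the dual objective strictly increases
for `ε > 0`. [cite: LuenbergerYe2008, §4.5 observation (b)] -/
theorem dualSimplexStep_objective_gt (B : Matrix m m ℝ) (lam b : m → ℝ) {i : m} (hx : (B⁻¹ *ᵥ b) i < 0)
    {ε : ℝ} (hε : 0 < ε) : lam ⬝ᵥ b < dualSimplexStep B lam i ε ⬝ᵥ b := by
  rw [dualSimplexStep_dotProduct_rhs]
  nlinarith

/-- Observation (b), weak form: for `ε ≥ 0` and `x_{Bi} ≤ 0` the dual objective does not decrease.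
[cite: LuenbergerYe2008, §4.5 (13) and observation (b)] -/
theorem dualSimplexStep_objective_ge (B : Matrix m m ℝ) (lam b : m → ℝ) {i : m} (hx : (B⁻¹ *ᵥ b) i ≤ 0)
    {ε : ℝ} (hε : 0 ≤ ε) : lam ⬝ᵥ b ≤ dualSimplexStep B lam i ε ⬝ᵥ b := by
  rw [dualSimplexStep_dotProduct_rhs]
  nlinarith

end Literature.Analysis.Convex.DualSimplexMethod
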